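/-
Copyright (c) 2026 the pub-hodgecm-mathlib formalisation cell (harness21).  Prover seat hodgecm-mathlib-LH5-p03 (g3): brick (B-norm) «PURE NORMAL WORDS» of the
letter-L1 clause (I₃) road (LH3-plan (g3) RULING #14 ∕ deal 2026-09-02T10:06Z; plan of record = LH5-p04 (g3)'s three-layer census 10:07:15Z, adopted token for token;
spec-owner F0P3a-p08 (g23) SPEC-I3 v1); 2026-09-02.
-/
import Literature.NumberTheory.Rogawski1990.ArchCartanWallExtensionGDocks      -- ★ p850857 (LH3-p02): `orbFamGExt`, `eventually_add_smul_hcNrm_mem_regG`, `hasOneSidedJump_congr`; brings ★ `ArchHCSpaceG` (`hcTwistedDeriv`, `hcAdaptedVec_normal`, `hcNrm`, `HcSemireg`), ★ `contDiff_archERhoG`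
import Literature.NumberTheory.Automorphic.ArchInnerFormChartOrbitalSmooth     -- ★ p850500∕p850509 (F0P3a-p02): `contDiffOn_orbFamGExt_regG`
import Literature.NumberTheory.Automorphic.ArchRankOneCasimirUniform           -- ★ p850750 (LH3-p04): `contDiffOn_orbitalIntegral_punctured`; brings ★ p850669 (L4) `exists_hasOneSidedJump_iteratedDeriv_orbitalIntegral`
import Literature.NumberTheory.Automorphic.Shelstad1979.OneSidedJumpLeibniz   -- ★ (F0P3a-p09): `hasOneSidedJump_iteratedFDeriv_mul_ray_of_jumps` (Leibniz for one-sided jumps, all orders, every word)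
import Literature.Analysis.Calculus.IteratedFDerivNestedDirectional       -- ★ p850982 (F0P3-p04 (g16)) (W): `NestedDirectional.iteratedFDeriv_apply_const_eq_iteratedDeriv_ray` (the (W1) ray identity, LOCAL `ContDiffOn`) — reused, not restated
import Mathlib.Analysis.Calculus.IteratedDeriv.Lemmas
import Mathlib.Algebra.BigOperators.Group.Finset.Powerset
import HarnessLib

/-!
# (B-norm) The jumps of the PURE-NORMAL jets of a `ρ`-twisted orbital family at a noncompact wall, from the normal-line descent identity
# `e^{ρ}·F(p + ν n) = m(ν)·Φ(ν)` (Leibniz for one-sided jumps × the rank-one Casimir ladder)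
# (Shelstad 1979 §4 Lemma 4.3, Prop. 4.5; Bouaziz 1994 §3.2 (I₃); Varadarajan 1989 §6.4 Thm 24)

Topic `NumberTheory/Rogawski1990`; namespace `Literature.NumberTheory.Rogawski1990`.  THEOREMS ONLY (no definition, no instance, no notation, no axiom, no named fact, no `sorry`).
Cell `pub/hodgecm-mathlib`, crux H413 = `stmt-HodgeConjecture-24833`, F0∕P3c line LH3 (closer stub `stub_N9`, DIRECT ROAD, letter L1 clause (I₃) `ArchHcJump (slotSign L α) jc′ (orbFamGExt L α ν′ a′)`
ALL ORDERS — spec SPEC-I3 v1 (F0P3a-p08 (g23)), road = LH3-p04 (g4)'s ladder digest): brick **(B-norm) «PURE NORMAL WORDS»** (LH3-plan (g3) RULING #14; plan of record = LH5-p04 (g3)'s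
three-layer census 2026-09-02T10:07:15Z, adopted token for token — credit LH5-p04; holder LH5-p03 (g3)).  Kernel lane `--supports stmt-HodgeConjecture-24833`; count-neutral.

THE MATHEMATICS.  (B-desc) (LH3-p04) exports, at a semiregular point `p` of the noncompact wall `(w, i, j)` of the chart `S′`, the NORMAL-LINE DESCENT IDENTITY
`e^{ρ}_{S′}(p + ν n) · F_{S′}(p + ν n) = m(ν) · Φ(ν)` on `0 < |ν| < δ`, with `m` smooth through `0` and `Φ = F_{f♭}` the normalised rank-one elliptic orbital integral of a smooth compactly
supported `f♭` (★ (ELL-∞) functional `F f ψ = 2 sin ψ · ∫_{U(1,1)} f(h t_z(ψ) h⁻¹) dμ`).  ★ (ELL-∞) (L1)+(L4) say: `Φ` is `C^∞` off `0` and EVERY jet `Φ⁽ᵏ⁾` has a one-sided jump `J_k` at `0` (odd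
`k`: `0`; `k = 2l`: `(−1)^l C₁ ·` cone integral of `(1+Ω)^l f♭`).  LEIBNIZ FOR JUMPS (★ `hasOneSidedJump_iteratedFDeriv_mul_ray_of_jumps`, read at `E = ℝ`, `x = 0`, `v = 1`, constant word,
the subset sum regrouped by cardinality): `(m·Φ)⁽ⁿ⁾` has the one-sided jump `Σ_{j=0}^{n} C(n,j) · m⁽ʲ⁾(0) · J_{n−j}`; the identity transports it to `(e^{ρ}F)⁽ⁿ⁾` along the normal (jets only see
the function off `0`); and the (I₃) left side at the PURE-NORMAL word `r ↦ (w, i)` IS that one-variable jet: `hcTwistedDeriv S′ n (fun _ => hcNrm w i j) (F S′) (p + ν n) = (t ↦ (e^{ρ}F)(p + t n))⁽ⁿ⁾(ν)`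
(★ `hcAdaptedVec_normal`; the ray lemma `Dⁿg(p + ν v)[v,…,v] = (g(p + · v))⁽ⁿ⁾(ν)` for `g` smooth near the point is ★ (W) `NestedDirectional.iteratedFDeriv_apply_const_eq_iteratedDeriv_ray`,
F0P3-p04 (g16) — hypothesis-free on `RegG S′` for `orbFamGExt` by ★ `contDiffOn_orbFamGExt_regG` + ★ `eventually_add_smul_hcNrm_mem_regG`).  NOT HERE (flagged in the census, spec §1): the junction of this value with the (I₃) RIGHT side `jc′·Iⁿ·∂ₓⁿ(e^{ρ}F_{S″})(cay p)` — that is (B-jc)∕(B-asm)'s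
(LH7-p04 (g4)) over the split-side descent identity, ★ (A0-CASIMIR-∞) and (B-wick).

WHAT IS PROVED (three layers).
* §1 (B-norm-gen), ONE REAL VARIABLE, group-free: `iteratedDeriv_congr_of_forall_abs`, `eventually_iteratedDeriv_eq_of_forall_abs`, `hasOneSidedJump_iteratedDeriv_of_forall_abs` (jets and jumps only
  see `0 < |ν| < δ`); **`hasOneSidedJump_iteratedDeriv_mul_of_jumps`** (`(m·Φ)⁽ⁿ⁾` jumps by `Σ_j C(n,j) m⁽ʲ⁾(0) J_{n−j}`); **`hasOneSidedJump_iteratedDeriv_of_eq_mul`** (the plan's head, token for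
  token: `g = m·h` on `0 < |ν| < δ` ⇒ `g⁽ⁿ⁾` jumps by that sum) + `exists_tendsto_iteratedDeriv_of_eq_mul` (the two one-sided limits).
* §2 (W1) DOCK LEMMAS over ★ (W) `NestedDirectional.iteratedFDeriv_apply_const_eq_iteratedDeriv_ray` (F0P3-p04 (g16), p850982; `Dⁿg(p + t v)[v,…,v] = (s ↦ g(p + s v))⁽ⁿ⁾(t)` for `g` `Cⁿ` on an
  open set through the point): `hcCayScalar_const_normal` (`= Iⁿ`), **`hcTwistedDeriv_normalWord_eq_iteratedDeriv`** (any family, smooth near the point); and in §3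
  `hcTwistedDeriv_normalWord_orbFamGExt_eventuallyEq_iteratedDeriv` (for `orbFamGExt`, hypothesis-free along `𝓝[≠] 0` at a semiregular wall point).
* §3 (B-norm-F) + (B-norm) DOCK: **`exists_hasOneSidedJump_iteratedDeriv_of_eq_mul_orbitalIntegral`** ((L1)+(L4)'s frame binders VERBATIM, `C₁` opened ONCE: `g = m · F f♭` on `0 < |ν| < δ` ⇒
  `g⁽ⁿ⁾` jumps by `Σ_j C(n,j) m⁽ʲ⁾(0) J_{n−j}(f♭)`, `J` by parity with (L4)'s cone text); **`hasOneSidedJump_hcTwistedDeriv_normalWord_of_descent`** (ANY family `F′` smooth near the punctured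
  normal segment); **`hasOneSidedJump_hcTwistedDeriv_normalWord_orbFamGExt_of_descent`** (the (I₃) left side of `orbFamGExt L α ν′ a′` at the pure-normal word, value
  `Σ_j C(n,j) m⁽ʲ⁾(0) J_{n−j}`, from the normal-line identity with ANY `Φ` whose jets jump — (B-asm) feeds (B-desc)'s witnesses and §3's `J`).
HONEST LABEL: HC_CM is proved only modulo the 7 printed citations (2 remaining: hLiu418 = `stmt-HodgeConjecture-24832`, h413 = `stmt-HodgeConjecture-24833`) until rung 0 closes; elementary
calculus over ★ heads, pays no organ by itself.

## References
* [Shelstad1979] D. Shelstad, *Characters and inner forms of a quasi-split group over ℝ*, Compositio Math. 39 (1979) 11–45, §4 Lemma 4.3 p. 25, Prop. 4.5 p. 26.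
* [Bouaziz1994IntegralesOrbitales] A. Bouaziz, *Intégrales orbitales sur les algèbres de Lie réductives*, Invent. Math. 115 (1994), §3.2 (I₃) p. 580.
* [Varadarajan1989] V. S. Varadarajan, *An Introduction to Harmonic Analysis on Semisimple Lie Groups*, Cambridge Stud. Adv. Math. 16 (1989), §6.4 Thms 23–24.
* [Varadarajan1977] V. S. Varadarajan, *Harmonic Analysis on Real Reductive Groups*, LNM 576 (1977), Part I §1.12.
* [HormanderALPDO1] L. Hörmander, *The Analysis of Linear Partial Differential Operators I* (1983), §1.1 (1.1.9) p. 12 (Leibniz).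
-/

set_option autoImplicit false

noncomputable section

open Complex Set Function Filter Topology Finset
open scoped ContDiff
open Literature.NumberTheory.Automorphic.Shelstad1979.StableOrbitalIntegrals
open Literature.NumberTheory.Automorphic.ArchCartan

namespace Literature.NumberTheory.Rogawski1990

/-! ## §1 (B-norm-gen) One real variable: jets and jumps only see `0 < |ν| < δ`; Leibniz for jumps in binomial form -/

section OneVariable

/-- The punctured symmetric interval `{ν | 0 < |ν| ∧ |ν| < δ}` is open. [cite: Shelstad1979, §4 p. 22] -/
theorem isOpen_setOf_abs_pos_abs_lt (δ : ℝ) : IsOpen {ν : ℝ | 0 < |ν| ∧ |ν| < δ} :=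
  (isOpen_lt continuous_const continuous_abs).inter (isOpen_lt continuous_abs continuous_const)

/-- For `0 < δ`, the punctured filter `𝓝[≠] 0` lives in `{ν | 0 < |ν| ∧ |ν| < δ}`. [cite: Shelstad1979, §4 p. 22] -/
theorem eventually_nhdsNE_abs_pos_abs_lt {δ : ℝ} (hδ : 0 < δ) : ∀ᶠ ν : ℝ in 𝓝[≠] (0 : ℝ), 0 < |ν| ∧ |ν| < δ := by
  have h1 : ∀ᶠ ν : ℝ in 𝓝 (0 : ℝ), |ν| < δ := by
    have : Tendsto (fun ν : ℝ => |ν|) (𝓝 0) (𝓝 0) := by simpa using (continuous_abs.tendsto (0 : ℝ))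
    exact this.eventually (Iio_mem_nhds hδ)
  filter_upwards [mem_nhdsWithin_of_mem_nhds h1, self_mem_nhdsWithin] with ν hν hν0
  exact ⟨abs_pos.2 hν0, hν⟩

/-- **Jets only see the function near the point**: if `G = K` on `0 < |ν| < δ`, their iterated derivatives of every order agree there. [cite: Varadarajan1989, §6.4] -/
theorem iteratedDeriv_congr_of_forall_abs {G K : ℝ → ℂ} {δ : ℝ} (h : ∀ ν : ℝ, 0 < |ν| → |ν| < δ → G ν = K ν) (n : ℕ) {ν : ℝ}
    (hν : 0 < |ν|) (hνδ : |ν| < δ) : iteratedDeriv n G ν = iteratedDeriv n K ν := by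
  have hGK : G =ᶠ[𝓝 ν] K := by
    filter_upwards [(isOpen_setOf_abs_pos_abs_lt δ).mem_nhds ⟨hν, hνδ⟩] with t ht using h t ht.1 ht.2
  rw [iteratedDeriv_eq_iteratedFDeriv, iteratedDeriv_eq_iteratedFDeriv, (hGK.iteratedFDeriv ℝ n).eq_of_nhds]

/-- Hence the jets of `G` and `K` agree eventually along `𝓝[≠] 0`. [cite: Varadarajan1989, §6.4] -/
theorem eventually_iteratedDeriv_eq_of_forall_abs {G K : ℝ → ℂ} {δ : ℝ} (hδ : 0 < δ) (h : ∀ ν : ℝ, 0 < |ν| → |ν| < δ → G ν = K ν) (n : ℕ) :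
    ∀ᶠ ν : ℝ in 𝓝[≠] (0 : ℝ), iteratedDeriv n G ν = iteratedDeriv n K ν := by
  filter_upwards [eventually_nhdsNE_abs_pos_abs_lt hδ] with ν hν using iteratedDeriv_congr_of_forall_abs h n hν.1 hν.2

/-- **One-sided jumps of jets only see `0 < |ν| < δ`**: if `G = K` there and `K⁽ⁿ⁾` has the one-sided jump `J` at `0`, so does `G⁽ⁿ⁾` (both one-sided filters lie below `𝓝[≠] 0`).
[cite: Shelstad1979, Prop. 4.5 (p. 26)] -/
theorem hasOneSidedJump_iteratedDeriv_of_forall_abs {G K : ℝ → ℂ} {δ : ℝ} (hδ : 0 < δ) (h : ∀ ν : ℝ, 0 < |ν| → |ν| < δ → G ν = K ν) {n : ℕ} {J : ℂ}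
    (hK : HasOneSidedJump (iteratedDeriv n K) J) : HasOneSidedJump (iteratedDeriv n G) J := by
  obtain ⟨Lp, Lm, hp, hm, hJ⟩ := hK
  have hev := (eventually_iteratedDeriv_eq_of_forall_abs hδ h n).mono fun ν hν => hν.symm
  exact ⟨Lp, Lm, hp.congr' (hev.filter_mono (nhdsGT_le_nhdsNE 0)), hm.congr' (hev.filter_mono (nhdsLT_le_nhdsNE 0)), hJ⟩

/-- **Regrouping a subset sum by cardinality**: `Σ_{s ⊆ Fin n} φ(|s|) = Σ_{j=0}^{n} C(n,j) · φ(j)`. [cite: HormanderALPDO1, §1.1 (1.1.9) p. 12] -/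
theorem sum_univ_finset_fin_card_eq_sum_range_choose (n : ℕ) (φ : ℕ → ℂ) :
    ∑ s : Finset (Fin n), φ s.card = ∑ j ∈ Finset.range (n + 1), (n.choose j : ℂ) * φ j := by
  rw [← Finset.powerset_univ, Finset.sum_powerset]
  simp only [Finset.card_univ, Fintype.card_fin]
  refine Finset.sum_congr rfl fun j _ => ?_
  rw [Finset.sum_powersetCard, Finset.card_univ, Fintype.card_fin, nsmul_eq_mul]

/-- **LEIBNIZ FOR ONE-SIDED JUMPS, ONE VARIABLE, BINOMIAL FORM.**  `m` is `C^∞` (on `ℝ`); `Φ` is `C^∞` on `0 < |ν| < δ`; every jet `Φ⁽ᵏ⁾`, `k ≤ n`, has a one-sided jump `J k` at `0`.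
Then `(m·Φ)⁽ⁿ⁾` has the one-sided jump `Σ_{j=0}^{n} C(n,j) · m⁽ʲ⁾(0) · J (n−j)` — ★ `hasOneSidedJump_iteratedFDeriv_mul_ray_of_jumps` at `E = ℝ`, `x = 0`, `v = 1`, the constant word, regrouped by
cardinality. [cite: Shelstad1979, Lemma 4.3 (p. 25); Prop. 4.5 (p. 26)] [cite: Bouaziz1994IntegralesOrbitales, §3.2 (I₃) p. 580] [cite: HormanderALPDO1, §1.1 (1.1.9) p. 12] -/
theorem hasOneSidedJump_iteratedDeriv_mul_of_jumps {m Φ : ℝ → ℂ} {δ : ℝ} (hδ : 0 < δ) (hm : ContDiff ℝ ∞ m)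
    (hΦ : ContDiffOn ℝ ∞ Φ {ν : ℝ | 0 < |ν| ∧ |ν| < δ}) (n : ℕ) {J : ℕ → ℂ}
    (hJ : ∀ k ≤ n, HasOneSidedJump (iteratedDeriv k Φ) (J k)) :
    HasOneSidedJump (iteratedDeriv n fun ν => m ν * Φ ν) (∑ j ∈ Finset.range (n + 1), (n.choose j : ℂ) * iteratedDeriv j m 0 * J (n - j)) := by
  have hray : ∀ᶠ t : ℝ in 𝓝[≠] (0 : ℝ), (0 : ℝ) + t • (1 : ℝ) ∈ {ν : ℝ | 0 < |ν| ∧ |ν| < δ} := by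
    filter_upwards [eventually_nhdsNE_abs_pos_abs_lt hδ] with t ht
    simpa only [zero_add, smul_eq_mul, mul_one] using ht
  -- the jets of `Φ` on the sub-words: all words are constant `1`, so these are the one-variable jets
  have hJ' : ∀ s : Finset (Fin n), HasOneSidedJump
      (fun t : ℝ => iteratedFDeriv ℝ s.card Φ ((0 : ℝ) + t • (1 : ℝ)) ((fun _ : Fin n => (1 : ℝ)) ∘ ⇑(s.orderEmbOfFin rfl))) (J s.card) := by
    intro s
    have hk : s.card ≤ n := by simpa only [Fintype.card_fin] using s.card_le_univ
    have he : (fun t : ℝ => iteratedFDeriv ℝ s.card Φ ((0 : ℝ) + t • (1 : ℝ)) ((fun _ : Fin n => (1 : ℝ)) ∘ ⇑(s.orderEmbOfFin rfl))) =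
        iteratedDeriv s.card Φ := by
      funext t
      simp only [zero_add, smul_eq_mul, mul_one, Function.comp_def]
      rfl
    rw [he]
    exact hJ _ hk
  have h := hasOneSidedJump_iteratedFDeriv_mul_ray_of_jumps (E := ℝ) isOpen_univ (isOpen_setOf_abs_pos_abs_lt δ) (Set.mem_univ (0 : ℝ))
    (v := (1 : ℝ)) hm.contDiffOn hΦ hray (n := n) (fun _ : Fin n => (1 : ℝ)) (J := fun s => J s.card) hJ'
  -- read the conclusion in one-variable currency
  have he : (fun t : ℝ => iteratedFDeriv ℝ n (fun y => m y * Φ y) ((0 : ℝ) + t • (1 : ℝ)) (fun _ : Fin n => (1 : ℝ))) =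
      iteratedDeriv n fun ν => m ν * Φ ν := by
    funext t
    simp only [zero_add, smul_eq_mul, mul_one]
    rfl
  rw [he] at h
  obtain ⟨Lp, Lm, hp, hm', hJ''⟩ := h
  refine ⟨Lp, Lm, hp, hm', ?_⟩
  rw [hJ'']
  have hsum : ∀ s : Finset (Fin n), iteratedFDeriv ℝ s.card m 0 ((fun _ : Fin n => (1 : ℝ)) ∘ ⇑(s.orderEmbOfFin rfl)) * J sᶜ.card =
      (fun k : ℕ => iteratedDeriv k m 0 * J (n - k)) s.card := by
    intro s
    simp only [Function.comp_def, Finset.card_compl, Fintype.card_fin]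
    rfl
  rw [Finset.sum_congr rfl fun s _ => hsum s, sum_univ_finset_fin_card_eq_sum_range_choose n (fun k : ℕ => iteratedDeriv k m 0 * J (n - k))]
  refine Finset.sum_congr rfl fun j _ => ?_
  ring

/-- **(B-norm-gen) — THE PLAN'S HEAD, TOKEN FOR TOKEN**: if `g = m · h` on `0 < |ν| < δ` with `m` smooth (through `0`) and `h` smooth off `0` whose jets `h⁽ᵏ⁾`, `k ≤ n`, have the
one-sided jumps `J k` at `0`, then `g⁽ⁿ⁾` has the one-sided jump `Σ_{j=0}^{n} C(n,j) · m⁽ʲ⁾(0) · J (n−j)` (credit: LH5-p04 (g3)'s census text).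
[cite: Shelstad1979, Lemma 4.3 (p. 25); Prop. 4.5 (p. 26)] [cite: Bouaziz1994IntegralesOrbitales, §3.2 (I₃) p. 580] [cite: Varadarajan1977, I §1.12] -/
theorem hasOneSidedJump_iteratedDeriv_of_eq_mul {g m h : ℝ → ℂ} {δ : ℝ} (hδ : 0 < δ) (hg : ∀ ν : ℝ, 0 < |ν| → |ν| < δ → g ν = m ν * h ν)
    (hm : ContDiff ℝ ∞ m) (hh : ContDiffOn ℝ ∞ h {ν : ℝ | 0 < |ν| ∧ |ν| < δ}) (n : ℕ) {J : ℕ → ℂ}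
    (hJ : ∀ k ≤ n, HasOneSidedJump (iteratedDeriv k h) (J k)) :
    HasOneSidedJump (iteratedDeriv n g) (∑ j ∈ Finset.range (n + 1), (n.choose j : ℂ) * iteratedDeriv j m 0 * J (n - j)) :=
  hasOneSidedJump_iteratedDeriv_of_forall_abs hδ hg (hasOneSidedJump_iteratedDeriv_mul_of_jumps hδ hm hh n hJ)

/-- **The `Tendsto` twin**: under the same hypotheses `g⁽ⁿ⁾` has both one-sided limits at `0` (the existence half that (I₁)'s one-sided clause consumes).
[cite: Shelstad1979, Thm. 4.7 (p. 31)] [cite: Bouaziz1994IntegralesOrbitales, §3.2 (I₁) p. 579] -/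
theorem exists_tendsto_iteratedDeriv_of_eq_mul {g m h : ℝ → ℂ} {δ : ℝ} (hδ : 0 < δ) (hg : ∀ ν : ℝ, 0 < |ν| → |ν| < δ → g ν = m ν * h ν)
    (hm : ContDiff ℝ ∞ m) (hh : ContDiffOn ℝ ∞ h {ν : ℝ | 0 < |ν| ∧ |ν| < δ}) (n : ℕ) {J : ℕ → ℂ}
    (hJ : ∀ k ≤ n, HasOneSidedJump (iteratedDeriv k h) (J k)) :
    ∃ Lp Lm : ℂ, Tendsto (iteratedDeriv n g) (𝓝[>] (0 : ℝ)) (𝓝 Lp) ∧ Tendsto (iteratedDeriv n g) (𝓝[<] (0 : ℝ)) (𝓝 Lm) ∧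
      Lp - Lm = ∑ j ∈ Finset.range (n + 1), (n.choose j : ℂ) * iteratedDeriv j m 0 * J (n - j) :=
  hasOneSidedJump_iteratedDeriv_of_eq_mul hδ hg hm hh n hJ

end OneVariable

/-! ## §2 (W1) The (I₃) left side at the pure-normal word is the one-variable jet along the normal (ray identity = ★ (W) `NestedDirectional.iteratedFDeriv_apply_const_eq_iteratedDeriv_ray`) -/

section Words

variable {W : Type*} [DecidableEq W]

/-- The Cayley scalar of the constant normal word of length `n` is `Iⁿ`. [cite: Shelstad1979, Lemma 4.3 (p. 25)] -/
theorem hcCayScalar_const_normal (w : W) (i : Fin 3) (n : ℕ) : hcCayScalar w i (fun _ : Fin n => (w, i)) = I ^ n := by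
  unfold hcCayScalar
  rw [Finset.filter_true_of_mem fun _ _ => rfl, Finset.card_univ, Fintype.card_fin]

variable [Fintype W]

/-- **THE (I₃) LEFT SIDE AT THE PURE-NORMAL WORD IS THE ONE-VARIABLE JET ALONG THE NORMAL**: for any family member `F′` with `c ↦ e^{ρ}_{S′}(c)·F′(c)` of class `C^∞` on an open set
through `p + ν n` (`n = hcNrm w i j`), `hcTwistedDeriv S′ k (fun _ => hcAdaptedVec w i j (w, i)) F′ (p + ν n) = (t ↦ e^{ρ}_{S′}(p + t n)·F′(p + t n))⁽ᵏ⁾(ν)` (★ `hcAdaptedVec_normal` + (W1)).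
[cite: Bouaziz1994IntegralesOrbitales, §3.2 (I₃) p. 580] [cite: Shelstad1979, Lemma 4.3 (p. 25)] -/
theorem hcTwistedDeriv_normalWord_eq_iteratedDeriv (S' : Finset W) (w : W) (i j : Fin 3) (F' : (W → Fin 3 → ℝ) → ℂ) {O : Set (W → Fin 3 → ℝ)} (hO : IsOpen O)
    (hsm : ContDiffOn ℝ ∞ (fun c => archERhoG S' c * F' c) O) {p : W → Fin 3 → ℝ} {ν : ℝ} (hν : p + ν • hcNrm w i j ∈ O) (k : ℕ) :
    hcTwistedDeriv S' k (fun r => hcAdaptedVec w i j ((fun _ : Fin k => (w, i)) r)) F' (p + ν • hcNrm w i j) =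
      iteratedDeriv k (fun t : ℝ => archERhoG S' (p + t • hcNrm w i j) * F' (p + t • hcNrm w i j)) ν := by
  unfold hcTwistedDeriv
  simp only [hcAdaptedVec_normal]
  exact Literature.Analysis.Calculus.NestedDirectional.iteratedFDeriv_apply_const_eq_iteratedDeriv_ray hO hsm p (hcNrm w i j) (by exact_mod_cast le_top) hν

end Words

/-! ## §3 (B-norm-F) the rank-one instance, and the (B-norm) dock at the pure-normal word -/

section RankOne

open _root_.MeasureTheory _root_.NumberField _root_.NumberField.InfinitePlace
open _root_.Literature.NumberTheory.Automorphic _root_.Literature.NumberTheory.Automorphic.UnitaryGroup _root_.Literature.NumberTheory.Automorphic.RankOneCasimir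
open scoped Real MatrixGroups ComplexConjugate Matrix.Norms.Operator Classical

/-- **(B-norm-F) — THE RANK-ONE INSTANCE, (L1)+(L4)'s frame binders VERBATIM, `C₁` opened ONCE.**  One `C₁ > 0` (★ (K0±)'s, through ★ (L4)) such that for every centre `z ∈ S¹`,
bound functional `F` (`hF`: `F f ψ = 2 sin ψ · ∫_{U(σa)} f(h t_z(ψ) h⁻¹) dμ`), `f ∈ C_c^∞(M₂(ℂ), ℂ)`, and every one-variable identity `g = m · F f` on `0 < |ν| < δ` with `m` smooth:
`g⁽ⁿ⁾` has both one-sided limits at `0` and the jump `Σ_{j=0}^{n} C(n,j) · m⁽ʲ⁾(0) · J_{n−j}(f)`, where `J_k(f) = 0` for odd `k` and `J_{2l}(f) = (−1)^l · C₁ ·` (the integral of `(1+Ω)^l f`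
over both nappes of the nilpotent cone at `z·1`, (L4)'s text) — Leibniz for jumps (§1) × ★ (L4) `exists_hasOneSidedJump_iteratedDeriv_orbitalIntegral` × ★ (L1)
`contDiffOn_orbitalIntegral_punctured` (on `0 < |ν| < min δ 1`). [cite: Varadarajan1989, §6.4 Thms 23–24] [cite: Shelstad1979, Lemma 4.3 (p. 25); Prop. 4.5 (p. 26)]
[cite: Bouaziz1994IntegralesOrbitales, §3.2 (I₃) p. 580] -/
theorem exists_hasOneSidedJump_iteratedDeriv_of_eq_mul_orbitalIntegral
    (L : Type) [Field L] (a : Fin 2 → L) (w : {w : InfinitePlace L // IsComplex w})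
    (ha : ∀ i, a i ≠ 0) (hreal : ∀ i, (w.1.embedding (a i)).im = 0) (hsgn : (w.1.embedding (a 0)).re * (w.1.embedding (a 1)).re < 0)
    {p q : ℝ} (hpq : p * q = 1) (hqe : (q : ℂ) ^ 2 * w.1.embedding (a 1) = -w.1.embedding (a 0))
    [MeasurableSpace (unitaryGroupOfForm (starRingEnd ℂ) ((Matrix.diagonal a).map w.1.embedding))]
    [BorelSpace (unitaryGroupOfForm (starRingEnd ℂ) ((Matrix.diagonal a).map w.1.embedding))]
    (μ : Measure (unitaryGroupOfForm (starRingEnd ℂ) ((Matrix.diagonal a).map w.1.embedding))) [μ.IsHaarMeasure] [μ.IsMulRightInvariant]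
    (Ω : (Matrix (Fin 2) (Fin 2) ℂ → ℂ) → Matrix (Fin 2) (Fin 2) ℂ → ℂ)
    (hΩ : ∀ (g : Matrix (Fin 2) (Fin 2) ℂ → ℂ) (Y : Matrix (Fin 2) (Fin 2) ℂ), Ω g Y =
      -(fderiv ℝ (fderiv ℝ g) Y (Y * !![I, 0; 0, -I]) (Y * !![I, 0; 0, -I]) + fderiv ℝ g Y (Y * !![I, 0; 0, -I] * !![I, 0; 0, -I])) +
        (fderiv ℝ (fderiv ℝ g) Y (Y * !![(0 : ℂ), (p : ℂ); (q : ℂ), 0]) (Y * !![(0 : ℂ), (p : ℂ); (q : ℂ), 0]) +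
          fderiv ℝ g Y (Y * !![(0 : ℂ), (p : ℂ); (q : ℂ), 0] * !![(0 : ℂ), (p : ℂ); (q : ℂ), 0])) +
        (fderiv ℝ (fderiv ℝ g) Y (Y * !![(0 : ℂ), -((p : ℂ) * I); (q : ℂ) * I, 0]) (Y * !![(0 : ℂ), -((p : ℂ) * I); (q : ℂ) * I, 0]) +
          fderiv ℝ g Y (Y * !![(0 : ℂ), -((p : ℂ) * I); (q : ℂ) * I, 0] * !![(0 : ℂ), -((p : ℂ) * I); (q : ℂ) * I, 0]))) :
    ∃ C₁ : ℝ, 0 < C₁ ∧ ∀ (z : Circle) (F : (Matrix (Fin 2) (Fin 2) ℂ → ℂ) → ℝ → ℂ)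
      (_hF : ∀ (g : Matrix (Fin 2) (Fin 2) ℂ → ℂ) (ψ : ℝ), F g ψ = (2 * Real.sin ψ) •
        ∫ h : unitaryGroupOfForm (starRingEnd ℂ) ((Matrix.diagonal a).map w.1.embedding),
          g (((h * ⟨circleDiagonal 2 ![z * Circle.exp ψ, z * Circle.exp (-ψ)], circleDiagonal_mem_archLocal_diagonal L 2 a w _⟩ * h⁻¹ :
            unitaryGroupOfForm (starRingEnd ℂ) ((Matrix.diagonal a).map w.1.embedding)) : GL (Fin 2) ℂ) : Matrix (Fin 2) (Fin 2) ℂ) ∂μ)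
      {f : Matrix (Fin 2) (Fin 2) ℂ → ℂ}, ContDiff ℝ ∞ f → HasCompactSupport f →
      ∀ {g m : ℝ → ℂ} {δ : ℝ}, 0 < δ → ContDiff ℝ ∞ m → (∀ ν : ℝ, 0 < |ν| → |ν| < δ → g ν = m ν * F f ν) → ∀ n : ℕ,
        HasOneSidedJump (iteratedDeriv n g)
          (∑ j ∈ Finset.range (n + 1), (n.choose j : ℂ) * iteratedDeriv j m 0 *
            (if Odd (n - j) then 0 else
              (-1 : ℂ) ^ ((n - j) / 2) * (C₁ : ℂ) * ((∫ p in Ioi (0 : ℝ) ×ˢ Ioc (0 : ℝ) (2 * π),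
                ((fun g => g + Ω g)^[(n - j) / 2] f) (Matrix.diagonal ![(((Real.sqrt |(w.1.embedding (a 0)).re|)⁻¹ : ℝ) : ℂ), (((Real.sqrt |(w.1.embedding (a 1)).re|)⁻¹ : ℝ) : ℂ)] *
                  ((z : ℂ) • (1 : Matrix (Fin 2) (Fin 2) ℂ) + p.1 • Matrix.diagonal ![(z : ℂ) * I, -((z : ℂ) * I)] +
                    p.1 • !![(0 : ℂ), -((z : ℂ) * I) * cexp (-((p.2 : ℂ) * I)); ((z : ℂ) * I) * cexp ((p.2 : ℂ) * I), 0]) *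
                  Matrix.diagonal ![((Real.sqrt |(w.1.embedding (a 0)).re| : ℝ) : ℂ), ((Real.sqrt |(w.1.embedding (a 1)).re| : ℝ) : ℂ)])) +
                ∫ p in Ioi (0 : ℝ) ×ˢ Ioc (0 : ℝ) (2 * π),
                ((fun g => g + Ω g)^[(n - j) / 2] f) (Matrix.diagonal ![(((Real.sqrt |(w.1.embedding (a 0)).re|)⁻¹ : ℝ) : ℂ), (((Real.sqrt |(w.1.embedding (a 1)).re|)⁻¹ : ℝ) : ℂ)] *
                  ((z : ℂ) • (1 : Matrix (Fin 2) (Fin 2) ℂ) + p.1 • Matrix.diagonal ![-((z : ℂ) * I), (z : ℂ) * I] +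
                    p.1 • !![(0 : ℂ), ((z : ℂ) * I) * cexp (-((p.2 : ℂ) * I)); -((z : ℂ) * I) * cexp ((p.2 : ℂ) * I), 0]) *
                  Matrix.diagonal ![((Real.sqrt |(w.1.embedding (a 0)).re| : ℝ) : ℂ), ((Real.sqrt |(w.1.embedding (a 1)).re| : ℝ) : ℂ)])))) := by
  obtain ⟨C₁, hC₁, H⟩ := exists_hasOneSidedJump_iteratedDeriv_orbitalIntegral L a w ha hreal hsgn hpq hqe μ Ω hΩ
  refine ⟨C₁, hC₁, fun z F hF f hf hfc g m δ hδ hm hg n => ?_⟩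
  -- the jumps of the jets of `F f`, by parity
  set J : ℕ → ℂ := fun k => if Odd k then 0 else
    (-1 : ℂ) ^ (k / 2) * (C₁ : ℂ) * ((∫ p in Ioi (0 : ℝ) ×ˢ Ioc (0 : ℝ) (2 * π),
      ((fun g => g + Ω g)^[k / 2] f) (Matrix.diagonal ![(((Real.sqrt |(w.1.embedding (a 0)).re|)⁻¹ : ℝ) : ℂ), (((Real.sqrt |(w.1.embedding (a 1)).re|)⁻¹ : ℝ) : ℂ)] *
        ((z : ℂ) • (1 : Matrix (Fin 2) (Fin 2) ℂ) + p.1 • Matrix.diagonal ![(z : ℂ) * I, -((z : ℂ) * I)] +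
          p.1 • !![(0 : ℂ), -((z : ℂ) * I) * cexp (-((p.2 : ℂ) * I)); ((z : ℂ) * I) * cexp ((p.2 : ℂ) * I), 0]) *
        Matrix.diagonal ![((Real.sqrt |(w.1.embedding (a 0)).re| : ℝ) : ℂ), ((Real.sqrt |(w.1.embedding (a 1)).re| : ℝ) : ℂ)])) +
      ∫ p in Ioi (0 : ℝ) ×ˢ Ioc (0 : ℝ) (2 * π),
      ((fun g => g + Ω g)^[k / 2] f) (Matrix.diagonal ![(((Real.sqrt |(w.1.embedding (a 0)).re|)⁻¹ : ℝ) : ℂ), (((Real.sqrt |(w.1.embedding (a 1)).re|)⁻¹ : ℝ) : ℂ)] *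
        ((z : ℂ) • (1 : Matrix (Fin 2) (Fin 2) ℂ) + p.1 • Matrix.diagonal ![-((z : ℂ) * I), (z : ℂ) * I] +
          p.1 • !![(0 : ℂ), ((z : ℂ) * I) * cexp (-((p.2 : ℂ) * I)); -((z : ℂ) * I) * cexp ((p.2 : ℂ) * I), 0]) *
        Matrix.diagonal ![((Real.sqrt |(w.1.embedding (a 0)).re| : ℝ) : ℂ), ((Real.sqrt |(w.1.embedding (a 1)).re| : ℝ) : ℂ)])) with hJdef
  have hJ : ∀ k : ℕ, HasOneSidedJump (iteratedDeriv k (F f)) (J k) := by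
    intro k
    obtain ⟨l, rfl | rfl⟩ := Nat.even_or_odd' k
    · have h2 := (H z F hF hf hfc l).2
      have hl : ¬ Odd (2 * l) := Nat.not_odd_iff_even.2 (even_two_mul l)
      have hdiv : 2 * l / 2 = l := by omega
      rw [hJdef]
      simp only [hl, if_false, hdiv]
      exact h2
    · have h1 := (H z F hF hf hfc l).1
      rw [hJdef]
      simp only [odd_two_mul_add_one, if_true]
      exact h1
  -- `F f` is smooth on `0 < |ν| < min δ 1` (★ (L1)), and the identity holds there
  have hδ1 : 0 < min δ 1 := lt_min hδ one_pos
  have hg1 : ∀ ν : ℝ, 0 < |ν| → |ν| < min δ 1 → g ν = m ν * F f ν := fun ν hν hν1 => hg ν hν (lt_of_lt_of_le hν1 (min_le_left _ _))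
  have hh : ContDiffOn ℝ ∞ (F f) {ν : ℝ | 0 < |ν| ∧ |ν| < min δ 1} := by
    refine (contDiffOn_orbitalIntegral_punctured L a w ha hreal hsgn hpq hqe μ Ω hΩ z F hF hf hfc).mono fun ν hν => ?_
    have h1 : |ν| < 1 := lt_of_lt_of_le hν.2 (min_le_right _ _)
    exact ⟨abs_lt.1 h1, by simpa only [Set.mem_compl_iff, Set.mem_singleton_iff] using abs_pos.1 hν.1⟩
  have hmain := hasOneSidedJump_iteratedDeriv_of_eq_mul hδ1 hg1 hm hh n (J := J) fun k _ => hJ k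
  simpa only [hJdef] using hmain

variable (L : Type) [Field L] [NumberField L] [IsCMField L] (α : Fin 3 → L)
  [MeasurableSpace ↥(arch (↥(maximalRealSubfield L)) L (IsCMField.complexConj L) 3 (Matrix.diagonal α))]
  [BorelSpace ↥(arch (↥(maximalRealSubfield L)) L (IsCMField.complexConj L) 3 (Matrix.diagonal α))]
  (ν' : Measure ↥(arch (↥(maximalRealSubfield L)) L (IsCMField.complexConj L) 3 (Matrix.diagonal α))) [IsFiniteMeasureOnCompacts ν'] [ν'.IsMulRightInvariant]

/-- **(B-norm) DOCK, ANY FAMILY**: if `c ↦ e^{ρ}_{S′}(c)·F′(c)` is `C^∞` on an open set met by the punctured normal line `p + ν n` (`n = hcNrm w i j`) for small `ν ≠ 0`, and the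
NORMAL-LINE DESCENT IDENTITY `e^{ρ}_{S′}(p + ν n)·F′(p + ν n) = m(ν)·Φ(ν)` holds on `0 < |ν| < δ` with `m` smooth and `Φ` smooth off `0` with jets jumping by `J k` (`k ≤ n`), then the
(I₃) LEFT SIDE at the pure-normal word of length `n` has both one-sided limits and the jump `Σ_{l=0}^{n} C(n,l) · m⁽ˡ⁾(0) · J (n−l)`. [cite: Bouaziz1994IntegralesOrbitales, §3.2 (I₃) p. 580]
[cite: Shelstad1979, Lemma 4.3 (p. 25); Prop. 4.5 (p. 26)] [cite: Varadarajan1977, I §1.12] -/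
theorem hasOneSidedJump_hcTwistedDeriv_normalWord_of_descent {W : Type*} [Fintype W] [DecidableEq W]
    (S' : Finset W) (w : W) (i j : Fin 3) (F' : (W → Fin 3 → ℝ) → ℂ) {O : Set (W → Fin 3 → ℝ)} (hO : IsOpen O)
    (hsm : ContDiffOn ℝ ∞ (fun c => archERhoG S' c * F' c) O) {p : W → Fin 3 → ℝ} (hpO : ∀ᶠ ν : ℝ in 𝓝[≠] (0 : ℝ), p + ν • hcNrm w i j ∈ O)
    {δ : ℝ} (hδ : 0 < δ) {m Φ : ℝ → ℂ}
    (hdesc : ∀ ν : ℝ, 0 < |ν| → |ν| < δ → archERhoG S' (p + ν • hcNrm w i j) * F' (p + ν • hcNrm w i j) = m ν * Φ ν)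
    (hm : ContDiff ℝ ∞ m) (hΦ : ContDiffOn ℝ ∞ Φ {ν : ℝ | 0 < |ν| ∧ |ν| < δ}) (n : ℕ) {J : ℕ → ℂ}
    (hJ : ∀ k ≤ n, HasOneSidedJump (iteratedDeriv k Φ) (J k)) :
    HasOneSidedJump (fun ν : ℝ => hcTwistedDeriv S' n (fun r => hcAdaptedVec w i j ((fun _ : Fin n => (w, i)) r)) F' (p + ν • hcNrm w i j))
      (∑ l ∈ Finset.range (n + 1), (n.choose l : ℂ) * iteratedDeriv l m 0 * J (n - l)) := by
  have hev : (fun ν : ℝ => hcTwistedDeriv S' n (fun r => hcAdaptedVec w i j ((fun _ : Fin n => (w, i)) r)) F' (p + ν • hcNrm w i j)) =ᶠ[𝓝[≠] (0 : ℝ)]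
      iteratedDeriv n (fun t : ℝ => archERhoG S' (p + t • hcNrm w i j) * F' (p + t • hcNrm w i j)) :=
    hpO.mono fun ν hν => hcTwistedDeriv_normalWord_eq_iteratedDeriv S' w i j F' hO hsm hν n
  exact (hasOneSidedJump_congr hev _).2 (hasOneSidedJump_iteratedDeriv_of_eq_mul hδ hdesc hm hΦ n hJ)

/-- **THE (I₃) LEFT SIDE OF `orbFamGExt` AT THE PURE-NORMAL WORD IS THE ONE-VARIABLE JET, HYPOTHESIS-FREE**: at a semiregular point `p` of the wall `(w, i, j)` (`w ∉ S′`,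
`i ≠ j`), for `a′ ∈ C_c^∞(G′_∞)`, eventually along `𝓝[≠] 0` the twisted pure-normal derivative of `orbFamGExt L α ν′ a′ S′` at `p + ν n` is
`(t ↦ e^{ρ}_{S′}(p + t n)·orbFamGExt … S′ (p + t n))⁽ᵏ⁾(ν)` (the normal curve runs in the open `RegG S′`, ★ `eventually_add_smul_hcNrm_mem_regG`, where the family is `C^∞`,
★ `contDiffOn_orbFamGExt_regG`, and `e^{ρ}` is `C^∞`, ★ `contDiff_archERhoG`). [cite: Varadarajan1977, I §1.12] [cite: Bouaziz1994IntegralesOrbitales, §3.2 (I₃) p. 580] -/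
theorem hcTwistedDeriv_normalWord_orbFamGExt_eventuallyEq_iteratedDeriv (hα : ∀ i, α i ≠ 0)
    {a' : ↥(arch (↥(maximalRealSubfield L)) L (IsCMField.complexConj L) 3 (Matrix.diagonal α)) → ℂ} (ha' : ArchSmooth L 3 (Matrix.diagonal α) a')
    {S' : Finset {w : InfinitePlace L // IsComplex w}} {w : {w : InfinitePlace L // IsComplex w}} (hw : w ∉ S') {i j : Fin 3} (hij : i ≠ j)
    {p : {w : InfinitePlace L // IsComplex w} → Fin 3 → ℝ} (hp : HcSemireg S' w i j p) (k : ℕ) :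
    (fun ν : ℝ => hcTwistedDeriv S' k (fun r => hcAdaptedVec w i j ((fun _ : Fin k => (w, i)) r)) (orbFamGExt L α ν' a' S') (p + ν • hcNrm w i j)) =ᶠ[𝓝[≠] (0 : ℝ)]
      iteratedDeriv k (fun t : ℝ => archERhoG S' (p + t • hcNrm w i j) * orbFamGExt L α ν' a' S' (p + t • hcNrm w i j)) := by
  have hsm : ContDiffOn ℝ ∞ (fun c => archERhoG S' c * orbFamGExt L α ν' a' S' c) (RegG S') :=
    (contDiff_archERhoG S').contDiffOn.mul (contDiffOn_orbFamGExt_regG L α ν' S' hα ha')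
  exact (eventually_add_smul_hcNrm_mem_regG hw hij hp).mono fun ν hν =>
    hcTwistedDeriv_normalWord_eq_iteratedDeriv S' w i j (orbFamGExt L α ν' a' S') (isOpen_regG S') hsm hν k

/-- **(B-norm) FOR `orbFamGExt` — THE (I₃) LEFT SIDE AT THE PURE-NORMAL WORD, FROM THE NORMAL-LINE DESCENT IDENTITY.**  At a semiregular point `p` of the noncompact wall `(w, i, j)`
of the chart `S′` (`w ∉ S′`, `i ≠ j`), for `a′ ∈ C_c^∞(G′_∞)`: if (B-desc)'s identity `e^{ρ}_{S′}(p + ν n) · orbFamGExt L α ν′ a′ S′ (p + ν n) = m(ν) · Φ(ν)` holds on `0 < |ν| < δ` with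
`m` smooth and `Φ` smooth off `0` whose jets jump by `J k` (`k ≤ n`; for `Φ = F f♭` these are (B-norm-F)'s `J_k(f♭)`), then for the pure-normal word of length `n`
`HasOneSidedJump (ν ↦ hcTwistedDeriv S′ n (r ↦ hcAdaptedVec w i j (w, i)) (orbFamGExt … S′) (p + ν n)) (Σ_{l=0}^{n} C(n,l) · m⁽ˡ⁾(0) · J (n−l))` — hypothesis-free in the family
(smoothness on `RegG S′`).  The junction of this value with the (I₃) right side is (B-jc)∕(B-asm)'s. [cite: Bouaziz1994IntegralesOrbitales, §3.2 (I₃) p. 580]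
[cite: Shelstad1979, Prop. 4.5 (p. 26)] [cite: Varadarajan1977, I §1.12] -/
theorem hasOneSidedJump_hcTwistedDeriv_normalWord_orbFamGExt_of_descent (hα : ∀ i, α i ≠ 0)
    {a' : ↥(arch (↥(maximalRealSubfield L)) L (IsCMField.complexConj L) 3 (Matrix.diagonal α)) → ℂ} (ha' : ArchSmooth L 3 (Matrix.diagonal α) a')
    {S' : Finset {w : InfinitePlace L // IsComplex w}} {w : {w : InfinitePlace L // IsComplex w}} (hw : w ∉ S') {i j : Fin 3} (hij : i ≠ j)
    {p : {w : InfinitePlace L // IsComplex w} → Fin 3 → ℝ} (hp : HcSemireg S' w i j p)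
    {δ : ℝ} (hδ : 0 < δ) {m Φ : ℝ → ℂ}
    (hdesc : ∀ ν : ℝ, 0 < |ν| → |ν| < δ →
      archERhoG S' (p + ν • hcNrm w i j) * orbFamGExt L α ν' a' S' (p + ν • hcNrm w i j) = m ν * Φ ν)
    (hm : ContDiff ℝ ∞ m) (hΦ : ContDiffOn ℝ ∞ Φ {ν : ℝ | 0 < |ν| ∧ |ν| < δ}) (n : ℕ) {J : ℕ → ℂ}
    (hJ : ∀ k ≤ n, HasOneSidedJump (iteratedDeriv k Φ) (J k)) :
    HasOneSidedJump (fun ν : ℝ => hcTwistedDeriv S' n (fun r => hcAdaptedVec w i j ((fun _ : Fin n => (w, i)) r)) (orbFamGExt L α ν' a' S') (p + ν • hcNrm w i j))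
      (∑ l ∈ Finset.range (n + 1), (n.choose l : ℂ) * iteratedDeriv l m 0 * J (n - l)) :=
  (hasOneSidedJump_congr (hcTwistedDeriv_normalWord_orbFamGExt_eventuallyEq_iteratedDeriv L α ν' hα ha' hw hij hp n) _).2
    (hasOneSidedJump_iteratedDeriv_of_eq_mul hδ hdesc hm hΦ n hJ)

end RankOne

end Literature.NumberTheory.Rogawski1990

end
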